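import Literature.NumberTheory.Rogawski1990.ArchChartOrbGIsolatePlace        -- ★ (J-iso) p851229 (F0P3a-p07 (g18)): `chartOrbG_eq_prod_mul_integral_group_isolate_of_not_mem`; brings ★ (A1), ★ `InvariantQuotientPiNormalized`
import Literature.NumberTheory.Rogawski1990.ArchOrbFamGSmoothModel           -- ★ (A4) (LH5-p02 (g4)): `forall_mem_pi_chartTorusGLoc_comm` (the `descConj` binder of a compact-place family)
import HarnessLib

/-!
# `chartOrbG` with ONE compact place isolated, the other places read as (split local quotients) × (ONE quotient of the remaining compact places)
# («(J-iso) §2 in the (A1) §3 currency»; Folland 1995 §2.2, §2.6 (2.52); Rogawski 1990 §8.2–8.3)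

Topic `NumberTheory/Rogawski1990`; namespace `Literature.NumberTheory.Automorphic.UnitaryGroup`.  THEOREMS ONLY (no `def`, no instance, no notation, no axiom, no named fact,
no `sorry`).  Cell `pub/hodgecm-mathlib`, crux H413 (`stmt-HodgeConjecture-24833`), F0∕P3c line LH3 (closer stub `stub_N9`, DIRECT ROAD `F0_P3c_StubN9Direct`, LEAF v6), organ
O-L1d «HC-CENTRAL ∕ SCALAR CORNERS»: the measure-theoretic half of brick **(J2-a)** «isolation in the unfolded currency» of A-p12 (g28)'s J2 census (2026-09-02T11:29:26Z; dealer
LH3-plan (g4) 11:37:33Z), seat F0P3a-p05 (g21).  Count-neutral bookkeeping: nothing here closes an organ.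

THE MATHEMATICS.  ★ (J-iso) §2 `chartOrbG_eq_prod_mul_integral_group_isolate_of_not_mem` writes, at a compact-chart place `w₀ ∉ S′` and a regular `c`,
`chartOrbG ν′ S′ a′ c = (Π_{w≠w₀} t_w(B′_w)) · ∫_{U(α)_{w₀}} Θ_c(x γ_{w₀}(c) x⁻¹) dν′_{w₀}(x)` with `Θ_c` the partial chart-orbital integral over the PRODUCT of the local quotients
`Π_{w≠w₀} (U_w ⧸ T′_w)`.  Here that product is re-read as `(Π_{w∈S′} (U_w ⧸ T′_w)) × ((Π_ι U_w) ⧸ Π_ι T′_w)`, `ι := {w ∕∕ w ∉ S′ ∧ w ≠ w₀}` the FLAT index of the remaining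
compact places (the index of ★ (J2-b) `contDiffOn_partialUnfoldedModel`): the index split `{w ≠ w₀} = S′ ⊔ ι` is Mathlib `MeasurableEquiv.piEquivPiSubtypeProd` followed by
`MeasurableEquiv.piCongrLeft` to the two flat index types (measure preserving: `measurePreserving_piEquivPiSubtypeProd`, `measurePreserving_piCongrLeft`), and the ι-quotients are ONE
quotient by ★ `map_quotientPiHomeomorph_quotientMeasure_pi` (as ★ (A1) §3) for ANY inversion-invariant Haar measure `ρ_ι` on `Π_ι T′_w` with coordinates `⊗_ι t_w` (`hρι`; supplied by
★ `exists_haar_map_subgroupPiCoords_eq_pi`).  Bochner change of variables along measurable equivalences only — no Fubini and no integrability beyond ★ (J-iso) §2's: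
* **`chartOrbG_eq_prod_mul_integral_group_isolate_splitQuotient`**:
  `chartOrbG ν′ S′ a′ c = (Π_{w≠w₀} t_w(B′_w)) · ∫_{U(α)_{w₀}} ( ∫ a′(e⁻¹(x γ_{w₀}(c) x⁻¹ ∣ (ẏ_w γ_w(c) ẏ_w⁻¹)_{w∈S′} ∣ ((g γ_ι(c) g⁻¹)_w)_{w∈ι})) d((⊗_{S′} ν′_w∕t_w) ⊗ ((⊗_ι ν′_w)∕ρ_ι))(y, gΠT′) ) dν′_{w₀}(x)`
  — the split places still as local QUOTIENTS in `descConj (γ_w(c)) T′_w _ id` currency (what ★ (A2)+(A3) transport and unfold), the remaining compact places through ONE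
  `descConj (γ_ι(c)) (Π_ι T′) _` (what ★ (A4′)∕(J2-b) differentiate), the `w₀`-slot a WHOLE-GROUP variable.
HONEST LABEL: HC_CM is proved only modulo the 7 printed citations (2 remaining: hLiu418 = `stmt-HodgeConjecture-24832`, h413 = `stmt-HodgeConjecture-24833`) until rung 0
closes; this file moves no row of the books.

## References
* [Folland1995] G. B. Folland, *A Course in Abstract Harmonic Analysis* (1995), §2.2 (product measures), §2.6 Thm. 2.49, (2.52).
* [Rogawski1990] J. D. Rogawski, *Automorphic Representations of Unitary Groups in Three Variables*, Ann. of Math. Stud. 123 (1990), §8.2 p. 122, §8.3 p. 124.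
* [Gelbart1975] S. Gelbart, *Automorphic Forms on Adele Groups* (1975), §10 p. 155 (10.19).
* [BorelJacquet1979] A. Borel, H. Jacquet, *Automorphic forms and automorphic representations*, PSPM 33.1 (1979), §4.1.
* [DeitmarEchterhoff2014] A. Deitmar, S. Echterhoff, *Principles of Harmonic Analysis*, 2nd ed. (2014), Cor. 1.5.4, Lemma 9.3.3.
-/

set_option autoImplicit false

noncomputable section

open MeasureTheory MeasureTheory.Measure NumberField NumberField.InfinitePlace Matrix Complex Topology
open Literature.MeasureTheory.Group Literature.NumberTheory.Rogawski1990
open scoped MatrixGroups Matrix Classical ENNReal NNReal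

namespace Literature.NumberTheory.Automorphic.UnitaryGroup

section IsolateSplitQuotient

variable (L : Type) [Field L] [NumberField L] [IsCMField L] (α : Fin 3 → L) (S' : Finset {w : InfinitePlace L // IsComplex w})
  [∀ w : {w : InfinitePlace L // IsComplex w}, MeasurableSpace ↥(archLocal L 3 (Matrix.diagonal α) w)]
  [∀ w : {w : InfinitePlace L // IsComplex w}, BorelSpace ↥(archLocal L 3 (Matrix.diagonal α) w)]
  -- ★ `locallyCompactSpace_archLocal_three` ∕ ★ `secondCountableTopology_archLocal_three` (theorems, not instances: supplied by the consumer with `haveI`)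
  [∀ w : {w : InfinitePlace L // IsComplex w}, LocallyCompactSpace ↥(archLocal L 3 (Matrix.diagonal α) w)]
  [∀ w : {w : InfinitePlace L // IsComplex w}, SecondCountableTopology ↥(archLocal L 3 (Matrix.diagonal α) w)]
  [MeasurableSpace ↥(arch (↥(maximalRealSubfield L)) L (IsCMField.complexConj L) 3 (Matrix.diagonal α))]
  [BorelSpace ↥(arch (↥(maximalRealSubfield L)) L (IsCMField.complexConj L) 3 (Matrix.diagonal α))]
  [∀ w : {w : InfinitePlace L // IsComplex w}, MeasurableSpace (↥(archLocal L 3 (Matrix.diagonal α) w) ⧸ chartTorusGLoc L α w S')]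
  [∀ w : {w : InfinitePlace L // IsComplex w}, BorelSpace (↥(archLocal L 3 (Matrix.diagonal α) w) ⧸ chartTorusGLoc L α w S')]
  (ν'w : ∀ w : {w : InfinitePlace L // IsComplex w}, Measure ↥(archLocal L 3 (Matrix.diagonal α) w)) [∀ w, (ν'w w).IsHaarMeasure] [∀ w, (ν'w w).IsMulRightInvariant]
  (ν' : Measure ↥(arch (↥(maximalRealSubfield L)) L (IsCMField.complexConj L) 3 (Matrix.diagonal α))) [ν'.IsHaarMeasure] [ν'.IsMulRightInvariant]
  (hν : ν' = (Measure.pi ν'w).map (archPiEquivCM 3 L (Matrix.diagonal α)).symm)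
  (t : ∀ w : {w : InfinitePlace L // IsComplex w}, Measure ↥(chartTorusGLoc L α w S')) [∀ w, (t w).IsHaarMeasure] [∀ w, (t w).IsInvInvariant]
  -- the isolated compact place `w₀` and the quotient of the REMAINING compact places, flat index `ι = {w ∕∕ w ∉ S′ ∧ w ≠ w₀}` (as ★ (J2-b))
  (w₀ : {w : InfinitePlace L // IsComplex w})
  [MeasurableSpace ((∀ i : {w : {w : InfinitePlace L // IsComplex w} // w ∉ S' ∧ w ≠ w₀}, ↥(archLocal L 3 (Matrix.diagonal α) i.1)) ⧸
    Subgroup.pi Set.univ (fun i : {w : {w : InfinitePlace L // IsComplex w} // w ∉ S' ∧ w ≠ w₀} => chartTorusGLoc L α i.1 S'))]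
  [BorelSpace ((∀ i : {w : {w : InfinitePlace L // IsComplex w} // w ∉ S' ∧ w ≠ w₀}, ↥(archLocal L 3 (Matrix.diagonal α) i.1)) ⧸
    Subgroup.pi Set.univ (fun i : {w : {w : InfinitePlace L // IsComplex w} // w ∉ S' ∧ w ≠ w₀} => chartTorusGLoc L α i.1 S'))]
  (ρι : Measure ↥(Subgroup.pi Set.univ (fun i : {w : {w : InfinitePlace L // IsComplex w} // w ∉ S' ∧ w ≠ w₀} => chartTorusGLoc L α i.1 S')))
  [ρι.IsHaarMeasure] [ρι.IsInvInvariant]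
  (hρι : Measure.map (subgroupPiCoords fun i : {w : {w : InfinitePlace L // IsComplex w} // w ∉ S' ∧ w ≠ w₀} => chartTorusGLoc L α i.1 S') ρι =
    Measure.pi fun i : {w : {w : InfinitePlace L // IsComplex w} // w ∉ S' ∧ w ≠ w₀} => t i.1)

include hν hρι in
/-- **(J-iso) §2 IN THE (A1) §3 CURRENCY — `w₀` ISOLATED AS A WHOLE GROUP, THE SPLIT PLACES AS LOCAL QUOTIENTS, THE REMAINING COMPACT PLACES AS ONE QUOTIENT.**  For admissible `S′`,
a compact-chart place `w₀ ∉ S′`, `c ∈ RegG S′`, `a′ ∈ C_c(G′_∞)` and any inversion-invariant Haar measure `ρ_ι` on `Π_ι T′_{S′,w}` with coordinates `⊗_ι t_w` (`hρι`),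
`chartOrbG ν′ S′ a′ c = (Π_{w≠w₀} t_w(B′_w)) · ∫_{U(α)_{w₀}} ( ∫_{(Π_{w∈S′} U_w⧸T′_w) × ((Π_ι U_w)⧸Π_ι T′_w)} a′(e⁻¹(x γ_{w₀}(c) x⁻¹ ∣ (ẏ_w γ_w(c) ẏ_w⁻¹)_{w∈S′} ∣ ((g γ_ι(c) g⁻¹)_w)_{w∈ι})) d((⊗_{S′} ν′_w∕t_w) ⊗ ((⊗_ι ν′_w)∕ρ_ι)) )
dν′_{w₀}(x)` (assembly of the `w₀`-slot by Mathlib `piEquivPiSubtypeProd (· = w₀)` + `piUnique`, as ★ (J-iso) §2).  ★ (J-iso) §2, then — inside the `x`-integral — the index split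
`{w ≠ w₀} = S′ ⊔ ι` (`piEquivPiSubtypeProd` + `piCongrLeft`, measure preserving) and ★ `map_quotientPiHomeomorph_quotientMeasure_pi` on the ι-factor (Bochner change of variables along
measurable equivalences; no Fubini, no integrability). [cite: Folland1995, §2.2; §2.6 Thm. 2.49, (2.52)] [cite: Rogawski1990, §8.2 p. 122; §8.3 p. 124] [cite: Gelbart1975, §10 p. 155 (10.19)]
[cite: BorelJacquet1979, §4.1] [cite: DeitmarEchterhoff2014, Cor. 1.5.4; Lemma 9.3.3] -/
theorem chartOrbG_eq_prod_mul_integral_group_isolate_splitQuotient (hα : ∀ i, α i ≠ 0) (hS' : ∀ w, w ∈ S' → w ∈ splitChartPlaces L α)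
    (hw₀ : w₀ ∉ S') {c : {w : InfinitePlace L // IsComplex w} → Fin 3 → ℝ} (hc : c ∈ ArchCartan.RegG S')
    {a' : ↥(arch (↥(maximalRealSubfield L)) L (IsCMField.complexConj L) 3 (Matrix.diagonal α)) → ℂ} (ha'c : Continuous a') (ha's : HasCompactSupport a') :
    chartOrbG L α ν' S' a' c =
      (∏ w' : {w : {w : InfinitePlace L // IsComplex w} // ¬ w = w₀}, ((t w'.1 (chartBoxImgGLoc L α w'.1 S')).toReal : ℂ)) *
        ∫ x : ↥(archLocal L 3 (Matrix.diagonal α) w₀),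
          (∫ q : (∀ s : {w : {w : InfinitePlace L // IsComplex w} // w ∈ S'}, ↥(archLocal L 3 (Matrix.diagonal α) s.1) ⧸ chartTorusGLoc L α s.1 S') ×
              ((∀ i : {w : {w : InfinitePlace L // IsComplex w} // w ∉ S' ∧ w ≠ w₀}, ↥(archLocal L 3 (Matrix.diagonal α) i.1)) ⧸
                Subgroup.pi Set.univ (fun i : {w : {w : InfinitePlace L // IsComplex w} // w ∉ S' ∧ w ≠ w₀} => chartTorusGLoc L α i.1 S')),
            a' ((archPiEquivCM 3 L (Matrix.diagonal α)).symm
              ((MeasurableEquiv.piEquivPiSubtypeProd (fun w : {w : InfinitePlace L // IsComplex w} => ↥(archLocal L 3 (Matrix.diagonal α) w)) (· = w₀)).symm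
                ((MeasurableEquiv.piUnique fun i : {w : {w : InfinitePlace L // IsComplex w} // w = w₀} => ↥(archLocal L 3 (Matrix.diagonal α) i.1)).symm
                    (x * gprimeBlockAt L α w₀ S' (c w₀) * x⁻¹),
                  fun w' : {w : {w : InfinitePlace L // IsComplex w} // ¬ w = w₀} =>
                    if h : w'.1 ∈ S' then
                      descConj (gprimeBlockAt L α w'.1 S' (c w'.1)) (chartTorusGLoc L α w'.1 S') (forall_mem_chartTorusGLoc_comm L α w'.1 S' (c w'.1)) id (q.1 ⟨w'.1, h⟩)
                    else
                      descConj (fun i : {w : {w : InfinitePlace L // IsComplex w} // w ∉ S' ∧ w ≠ w₀} => gprimeBlock L α i.1 S' c)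
                        (Subgroup.pi Set.univ (fun i : {w : {w : InfinitePlace L // IsComplex w} // w ∉ S' ∧ w ≠ w₀} => chartTorusGLoc L α i.1 S'))
                        (forall_mem_pi_chartTorusGLoc_comm L α S' (fun i : {w : {w : InfinitePlace L // IsComplex w} // w ∉ S' ∧ w ≠ w₀} => i.1) c)
                        (fun g => (g ⟨w'.1, ⟨h, w'.2⟩⟩ : ↥(archLocal L 3 (Matrix.diagonal α) w'.1))) q.2)))
            ∂((Measure.pi fun s : {w : {w : InfinitePlace L // IsComplex w} // w ∈ S'} =>
                  quotientMeasure (chartTorusGLoc L α s.1 S') (t s.1) (isClosed_chartTorusGLoc L α s.1 S') (ν'w s.1)).prod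
              (quotientMeasure (Subgroup.pi Set.univ (fun i : {w : {w : InfinitePlace L // IsComplex w} // w ∉ S' ∧ w ≠ w₀} => chartTorusGLoc L α i.1 S')) ρι
                (isClosed_coe_pi _ fun i => isClosed_chartTorusGLoc L α i.1 S')
                (Measure.pi fun i : {w : {w : InfinitePlace L // IsComplex w} // w ∉ S' ∧ w ≠ w₀} => ν'w i.1))))
          ∂(ν'w w₀) := by
  -- ### instances (as ★ (A1) §3 ∕ ★ (J-iso) §2)
  haveI : ∀ w : {w : InfinitePlace L // IsComplex w}, IsClosed (chartTorusGLoc L α w S' : Set ↥(archLocal L 3 (Matrix.diagonal α) w)) :=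
    fun w => isClosed_chartTorusGLoc L α w S'
  haveI : ∀ w : {w : InfinitePlace L // IsComplex w}, SecondCountableTopology (↥(archLocal L 3 (Matrix.diagonal α) w) ⧸ chartTorusGLoc L α w S') := fun w => inferInstance
  haveI : ∀ w : {w : InfinitePlace L // IsComplex w},
      SigmaFinite (quotientMeasure (chartTorusGLoc L α w S') (t w) (isClosed_chartTorusGLoc L α w S') (ν'w w)) := fun w => inferInstance
  haveI : ∀ w, LocallyCompactSpace ↥(chartTorusGLoc L α w S') := fun w => locallyCompactSpace_chartTorusGLoc L α w S'
  haveI : ∀ w, SecondCountableTopology ↥(chartTorusGLoc L α w S') := fun w => TopologicalSpace.Subtype.secondCountableTopology _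
  haveI : ∀ w, SigmaFinite (t w) := fun w => inferInstance
  have hMι : IsClosed ((Subgroup.pi Set.univ (fun i : {w : {w : InfinitePlace L // IsComplex w} // w ∉ S' ∧ w ≠ w₀} => chartTorusGLoc L α i.1 S')) :
      Set (∀ i : {w : {w : InfinitePlace L // IsComplex w} // w ∉ S' ∧ w ≠ w₀}, ↥(archLocal L 3 (Matrix.diagonal α) i.1))) :=
    isClosed_coe_pi _ fun i => isClosed_chartTorusGLoc L α i.1 S'
  haveI : LocallyCompactSpace ↥(Subgroup.pi Set.univ (fun i : {w : {w : InfinitePlace L // IsComplex w} // w ∉ S' ∧ w ≠ w₀} => chartTorusGLoc L α i.1 S')) :=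
    hMι.isClosedEmbedding_subtypeVal.locallyCompactSpace
  haveI : SecondCountableTopology ↥(Subgroup.pi Set.univ (fun i : {w : {w : InfinitePlace L // IsComplex w} // w ∉ S' ∧ w ≠ w₀} => chartTorusGLoc L α i.1 S')) :=
    TopologicalSpace.Subtype.secondCountableTopology _
  haveI : SFinite ρι := inferInstance
  rw [chartOrbG_eq_prod_mul_integral_group_isolate_of_not_mem L α S' ν'w ν' hν t hα hS' hw₀ hc ha'c ha's]
  -- ### the index split `{w ≠ w₀} = S′ ⊔ ι`: an EXPLICIT measurable equivalence from the flat-indexed product, measure preserving (Mathlib `Measure.pi_eq` on boxes)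
  obtain ⟨Φ, hΦapp, hΦ⟩ : ∃ Φ : ((∀ s : {w : {w : InfinitePlace L // IsComplex w} // w ∈ S'}, ↥(archLocal L 3 (Matrix.diagonal α) s.1) ⧸ chartTorusGLoc L α s.1 S') ×
        (∀ i : {w : {w : InfinitePlace L // IsComplex w} // w ∉ S' ∧ w ≠ w₀}, ↥(archLocal L 3 (Matrix.diagonal α) i.1) ⧸ chartTorusGLoc L α i.1 S')) ≃ᵐ
      (∀ w' : {w : {w : InfinitePlace L // IsComplex w} // ¬ w = w₀}, ↥(archLocal L 3 (Matrix.diagonal α) w'.1) ⧸ chartTorusGLoc L α w'.1 S'),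
      (∀ (p : (∀ s : {w : {w : InfinitePlace L // IsComplex w} // w ∈ S'}, ↥(archLocal L 3 (Matrix.diagonal α) s.1) ⧸ chartTorusGLoc L α s.1 S') ×
          (∀ i : {w : {w : InfinitePlace L // IsComplex w} // w ∉ S' ∧ w ≠ w₀}, ↥(archLocal L 3 (Matrix.diagonal α) i.1) ⧸ chartTorusGLoc L α i.1 S'))
        (w' : {w : {w : InfinitePlace L // IsComplex w} // ¬ w = w₀}), Φ p w' = if h : w'.1 ∈ S' then p.1 ⟨w'.1, h⟩ else p.2 ⟨w'.1, ⟨h, w'.2⟩⟩) ∧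
      MeasurePreserving Φ
        ((Measure.pi fun s : {w : {w : InfinitePlace L // IsComplex w} // w ∈ S'} =>
            quotientMeasure (chartTorusGLoc L α s.1 S') (t s.1) (isClosed_chartTorusGLoc L α s.1 S') (ν'w s.1)).prod
          (Measure.pi fun i : {w : {w : InfinitePlace L // IsComplex w} // w ∉ S' ∧ w ≠ w₀} =>
            quotientMeasure (chartTorusGLoc L α i.1 S') (t i.1) (isClosed_chartTorusGLoc L α i.1 S') (ν'w i.1)))
        (Measure.pi fun w' : {w : {w : InfinitePlace L // IsComplex w} // ¬ w = w₀} =>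
          quotientMeasure (chartTorusGLoc L α w'.1 S') (t w'.1) (isClosed_chartTorusGLoc L α w'.1 S') (ν'w w'.1)) := by
    obtain ⟨f, hf⟩ : ∃ f : (∀ s : {w : {w : InfinitePlace L // IsComplex w} // w ∈ S'}, ↥(archLocal L 3 (Matrix.diagonal α) s.1) ⧸ chartTorusGLoc L α s.1 S') ×
          (∀ i : {w : {w : InfinitePlace L // IsComplex w} // w ∉ S' ∧ w ≠ w₀}, ↥(archLocal L 3 (Matrix.diagonal α) i.1) ⧸ chartTorusGLoc L α i.1 S') →
        (∀ w' : {w : {w : InfinitePlace L // IsComplex w} // ¬ w = w₀}, ↥(archLocal L 3 (Matrix.diagonal α) w'.1) ⧸ chartTorusGLoc L α w'.1 S'),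
        f = fun p w' => if h : w'.1 ∈ S' then p.1 ⟨w'.1, h⟩ else p.2 ⟨w'.1, ⟨h, w'.2⟩⟩ := ⟨_, rfl⟩
    have hfapp : ∀ (p : (∀ s : {w : {w : InfinitePlace L // IsComplex w} // w ∈ S'}, ↥(archLocal L 3 (Matrix.diagonal α) s.1) ⧸ chartTorusGLoc L α s.1 S') ×
          (∀ i : {w : {w : InfinitePlace L // IsComplex w} // w ∉ S' ∧ w ≠ w₀}, ↥(archLocal L 3 (Matrix.diagonal α) i.1) ⧸ chartTorusGLoc L α i.1 S'))
        (w' : {w : {w : InfinitePlace L // IsComplex w} // ¬ w = w₀}), f p w' = if h : w'.1 ∈ S' then p.1 ⟨w'.1, h⟩ else p.2 ⟨w'.1, ⟨h, w'.2⟩⟩ :=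
      fun p w' => by rw [hf]
    refine ⟨{ toFun := f
              invFun := fun b => (fun s => b ⟨s.1, fun h => absurd (h ▸ s.2) hw₀⟩, fun i => b ⟨i.1, i.2.2⟩)
              left_inv := fun p => ?_
              right_inv := fun b => ?_
              measurable_toFun := ?_
              measurable_invFun := ?_ }, hfapp, ?_⟩
    · refine Prod.ext (funext fun s => ?_) (funext fun i => ?_)
      · show f p ⟨s.1, fun h => absurd (h ▸ s.2) hw₀⟩ = p.1 s
        rw [hfapp, dif_pos s.2]
      · show f p ⟨i.1, i.2.2⟩ = p.2 i
        rw [hfapp, dif_neg i.2.1]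
    · funext w'
      show f (fun s => b ⟨s.1, fun h => absurd (h ▸ s.2) hw₀⟩, fun i => b ⟨i.1, i.2.2⟩) w' = b w'
      rw [hfapp]
      by_cases h : w'.1 ∈ S'
      · rw [dif_pos h]
      · rw [dif_neg h]
    · show Measurable f
      rw [hf]
      exact measurable_pi_lambda _ fun w' => by
        by_cases h : w'.1 ∈ S'
        · simp only [dif_pos h]
          exact (measurable_pi_apply _).comp measurable_fst
        · simp only [dif_neg h]
          exact (measurable_pi_apply _).comp measurable_snd
    · exact (measurable_pi_lambda _ fun s => measurable_pi_apply _).prodMk (measurable_pi_lambda _ fun i => measurable_pi_apply _)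
    · refine ⟨MeasurableEquiv.measurable _, (Measure.pi_eq fun s _ => ?_).symm⟩
      have hpre : f ⁻¹' Set.pi Set.univ s =
          (Set.pi Set.univ fun j : {w : {w : InfinitePlace L // IsComplex w} // w ∈ S'} => s ⟨j.1, fun h => absurd (h ▸ j.2) hw₀⟩) ×ˢ
            Set.pi Set.univ fun i : {w : {w : InfinitePlace L // IsComplex w} // w ∉ S' ∧ w ≠ w₀} => s ⟨i.1, i.2.2⟩ := by
        ext p
        simp only [Set.mem_preimage, Set.mem_pi, Set.mem_univ, true_implies, Set.mem_prod, hfapp]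
        constructor
        · intro hp
          exact ⟨fun j => by simpa only [dif_pos j.2, Subtype.coe_eta] using hp ⟨j.1, fun h => absurd (h ▸ j.2) hw₀⟩,
            fun i => by simpa only [dif_neg i.2.1, Subtype.coe_eta] using hp ⟨i.1, i.2.2⟩⟩
        · rintro ⟨h₁, h₂⟩ w'
          by_cases h : w'.1 ∈ S'
          · simp only [dif_pos h]
            exact h₁ ⟨w'.1, h⟩
          · simp only [dif_neg h]
            exact h₂ ⟨w'.1, ⟨h, w'.2⟩⟩
      rw [MeasurableEquiv.map_apply, MeasurableEquiv.coe_mk, Equiv.coe_fn_mk, hpre, Measure.prod_prod, Measure.pi_pi, Measure.pi_pi]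
      refine Eq.trans ?_ (Fintype.prod_subtype_mul_prod_subtype (fun w' : {w : {w : InfinitePlace L // IsComplex w} // ¬ w = w₀} => w'.1 ∈ S')
        (fun w' => quotientMeasure (chartTorusGLoc L α w'.1 S') (t w'.1) (isClosed_chartTorusGLoc L α w'.1 S') (ν'w w'.1) (s w')))
      exact congrArg₂ (· * ·)
        (Fintype.prod_equiv (⟨fun j => ⟨⟨j.1, fun h => absurd (h ▸ j.2) hw₀⟩, j.2⟩, fun j => ⟨j.1.1, j.2⟩, fun _ => rfl, fun _ => rfl⟩ :
            {w : {w : InfinitePlace L // IsComplex w} // w ∈ S'} ≃ {w' : {w : {w : InfinitePlace L // IsComplex w} // ¬ w = w₀} // w'.1 ∈ S'}) _ _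
          fun _ => rfl)
        (Fintype.prod_equiv (⟨fun i => ⟨⟨i.1, i.2.2⟩, i.2.1⟩, fun j => ⟨j.1.1, ⟨j.2, j.1.2⟩⟩, fun _ => rfl, fun _ => rfl⟩ :
            {w : {w : InfinitePlace L // IsComplex w} // w ∉ S' ∧ w ≠ w₀} ≃ {w' : {w : {w : InfinitePlace L // IsComplex w} // ¬ w = w₀} // ¬ w'.1 ∈ S'}) _ _
          fun _ => rfl)
  -- ### the ι-quotients as ONE quotient (★ `map_quotientPiHomeomorph_quotientMeasure_pi`, as ★ (A1) §3)
  set qπ := quotientPiHomeomorph (fun i : {w : {w : InfinitePlace L // IsComplex w} // w ∉ S' ∧ w ≠ w₀} => chartTorusGLoc L α i.1 S') with hqπ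
  have hq : MeasurePreserving qπ.toMeasurableEquiv
      (quotientMeasure (Subgroup.pi Set.univ (fun i : {w : {w : InfinitePlace L // IsComplex w} // w ∉ S' ∧ w ≠ w₀} => chartTorusGLoc L α i.1 S')) ρι
        (isClosed_coe_pi _ fun i => isClosed_chartTorusGLoc L α i.1 S')
        (Measure.pi fun i : {w : {w : InfinitePlace L // IsComplex w} // w ∉ S' ∧ w ≠ w₀} => ν'w i.1))
      (Measure.pi fun i : {w : {w : InfinitePlace L // IsComplex w} // w ∉ S' ∧ w ≠ w₀} =>
        quotientMeasure (chartTorusGLoc L α i.1 S') (t i.1) (isClosed_chartTorusGLoc L α i.1 S') (ν'w i.1)) :=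
    ⟨qπ.toMeasurableEquiv.measurable, by
      rw [Homeomorph.toMeasurableEquiv_coe]
      exact map_quotientPiHomeomorph_quotientMeasure_pi (fun i : {w : {w : InfinitePlace L // IsComplex w} // w ∉ S' ∧ w ≠ w₀} => chartTorusGLoc L α i.1 S')
        (fun i => isClosed_chartTorusGLoc L α i.1 S') (fun i => t i.1) ρι hρι (fun i => ν'w i.1)⟩
  have hE := (MeasurePreserving.id (Measure.pi fun s : {w : {w : InfinitePlace L // IsComplex w} // w ∈ S'} =>
      quotientMeasure (chartTorusGLoc L α s.1 S') (t s.1) (isClosed_chartTorusGLoc L α s.1 S') (ν'w s.1))).prod hq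
  -- ### the pointwise reading of the re-indexed, re-folded quotient family
  have hpt : ∀ (x : ↥(archLocal L 3 (Matrix.diagonal α) w₀))
      (ys : ∀ s : {w : {w : InfinitePlace L // IsComplex w} // w ∈ S'}, ↥(archLocal L 3 (Matrix.diagonal α) s.1) ⧸ chartTorusGLoc L α s.1 S')
      (g : ∀ i : {w : {w : InfinitePlace L // IsComplex w} // w ∉ S' ∧ w ≠ w₀}, ↥(archLocal L 3 (Matrix.diagonal α) i.1)),
      a' ((archPiEquivCM 3 L (Matrix.diagonal α)).symm
        ((MeasurableEquiv.piEquivPiSubtypeProd (fun w : {w : InfinitePlace L // IsComplex w} => ↥(archLocal L 3 (Matrix.diagonal α) w)) (· = w₀)).symm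
          ((MeasurableEquiv.piUnique fun i : {w : {w : InfinitePlace L // IsComplex w} // w = w₀} => ↥(archLocal L 3 (Matrix.diagonal α) i.1)).symm
              (x * gprimeBlockAt L α w₀ S' (c w₀) * x⁻¹),
            fun w' : {w : {w : InfinitePlace L // IsComplex w} // ¬ w = w₀} =>
              descConj (gprimeBlockAt L α w'.1 S' (c w'.1)) (chartTorusGLoc L α w'.1 S') (forall_mem_chartTorusGLoc_comm L α w'.1 S' (c w'.1)) id
                (Φ (ys, qπ (QuotientGroup.mk g)) w')))) =
      a' ((archPiEquivCM 3 L (Matrix.diagonal α)).symm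
        ((MeasurableEquiv.piEquivPiSubtypeProd (fun w : {w : InfinitePlace L // IsComplex w} => ↥(archLocal L 3 (Matrix.diagonal α) w)) (· = w₀)).symm
          ((MeasurableEquiv.piUnique fun i : {w : {w : InfinitePlace L // IsComplex w} // w = w₀} => ↥(archLocal L 3 (Matrix.diagonal α) i.1)).symm
              (x * gprimeBlockAt L α w₀ S' (c w₀) * x⁻¹),
            fun w' : {w : {w : InfinitePlace L // IsComplex w} // ¬ w = w₀} =>
              if h : w'.1 ∈ S' then
                descConj (gprimeBlockAt L α w'.1 S' (c w'.1)) (chartTorusGLoc L α w'.1 S') (forall_mem_chartTorusGLoc_comm L α w'.1 S' (c w'.1)) id (ys ⟨w'.1, h⟩)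
              else
                descConj (fun i : {w : {w : InfinitePlace L // IsComplex w} // w ∉ S' ∧ w ≠ w₀} => gprimeBlock L α i.1 S' c)
                  (Subgroup.pi Set.univ (fun i : {w : {w : InfinitePlace L // IsComplex w} // w ∉ S' ∧ w ≠ w₀} => chartTorusGLoc L α i.1 S'))
                  (forall_mem_pi_chartTorusGLoc_comm L α S' (fun i : {w : {w : InfinitePlace L // IsComplex w} // w ∉ S' ∧ w ≠ w₀} => i.1) c)
                  (fun g' => (g' ⟨w'.1, ⟨h, w'.2⟩⟩ : ↥(archLocal L 3 (Matrix.diagonal α) w'.1))) (QuotientGroup.mk g)))) := by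
    intro x ys g
    refine congrArg (fun V : (∀ w' : {w : {w : InfinitePlace L // IsComplex w} // ¬ w = w₀}, ↥(archLocal L 3 (Matrix.diagonal α) w'.1)) =>
      a' ((archPiEquivCM 3 L (Matrix.diagonal α)).symm
        ((MeasurableEquiv.piEquivPiSubtypeProd (fun w : {w : InfinitePlace L // IsComplex w} => ↥(archLocal L 3 (Matrix.diagonal α) w)) (· = w₀)).symm
          ((MeasurableEquiv.piUnique fun i : {w : {w : InfinitePlace L // IsComplex w} // w = w₀} => ↥(archLocal L 3 (Matrix.diagonal α) i.1)).symm
              (x * gprimeBlockAt L α w₀ S' (c w₀) * x⁻¹), V)))) (funext fun w' => ?_)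
    rw [hΦapp]
    by_cases h : w'.1 ∈ S'
    · rw [dif_pos h, dif_pos h]
    · rw [dif_neg h, dif_neg h]
      simp only [hqπ, coe_quotientPiHomeomorph, quotientPiEquiv_mk, descConj_mk, id_eq, Pi.mul_apply, Pi.inv_apply, gprimeBlock_eq_gprimeBlockAt]
  -- ### assemble: Bochner change of variables along `Φ` and `id × qπ` inside the `x`-integral
  congr 1
  refine integral_congr_ae (Filter.Eventually.of_forall fun x => ?_)
  simp only []
  rw [← hΦ.integral_comp', ← hE.integral_comp' (f := MeasurableEquiv.prodCongr (MeasurableEquiv.refl _) qπ.toMeasurableEquiv)]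
  refine integral_congr_ae (Filter.Eventually.of_forall fun q => ?_)
  obtain ⟨ys, z⟩ := q
  induction z using QuotientGroup.induction_on with
  | H g => exact hpt x ys g

end IsolateSplitQuotient

end Literature.NumberTheory.Automorphic.UnitaryGroup

end
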